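import Summits.QuantumFields.BalabanUV.Beta.FP.PerfectTelescopingFiniteComposite
import Summits.QuantumFields.BalabanUV.Beta.HessKerDressedUnits

/-!
# `BalabanUV.Beta.FP.PerfectTelescopingFiniteUnits` — road «FP» for binder row D1, leaf N7 ∕ sub-row **MS-1-FIN** (units): the finite-level
# (MS-1) of `PerfectTelescopingFiniteComposite.kTot_pair_telescoping_step` IN THE UNIT-RESCALED CURRENCY `unitK (sf j) (sm j)` whose `j → ∞`
# limits ARE the perfect resolvents `KPerf`, with the composite's scalar READ OFF: `((Lc^j)^(d+2))² ∕ (sm j · sf (j+m))²` — in the adopted units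
# `sf j = Lc^j`, `sm j = Lc^{j(d+1)}` this is `(Lc^m)^{−2}`, INDEPENDENT of `j` («C^{[n]} = n^{−2}·C(·∕n)»: the N7 PLAN's `p_C = 2`)

HONEST FRAMING (cell contract, verbatim): «discharging `BetaPertH` makes Bałaban's UV stability UNCONDITIONAL — a real constructive-QFT
result; it is NOT the continuum limit and NOT the Clay problem.»  HONEST DEPENDENCY (verbatim): «continuum YM on T⁴ ⇐ BetaPertH ∧ nine
spine estimates (0/9 proved); BetaPertH ⇐ (D1) ∧ (D4) ∧ CAP+tail; G-an2-4 gates asym, D1 and NE2/3/4.»  THIS MODULE DISCHARGES NOTHING of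
the wall: [folklore] scalar bookkeeping (pulling leg-type-constant units through finite sums, `tsum`s and the weighted lift) over asym1's
`HessKerDressedUnits.unitK` and the two landed MS-1-FIN modules, BY NAME.  No `def`, no `Prop` minted, nothing cited, no hypothesis is a printed
statement, 0 sorry.  0 wall binders; NOT `hasym`, NOT the limit `j → ∞` (MS-1 proper), NOT D1, NOT `BetaPertH`, NOT continuum, NOT Clay.

ABSOLUTE RULE (cell charter, verbatim): «No internally-minted statement may enter as a cited fact. Every hypothesis is either kernel-proved
in this package or a verbatim quotation of a PUBLISHED theorem with page reference. The manuscript(s) under audit are NOT citable for their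
own disputed steps — they are the thing under adjudication; programme-internal (2001/route/tribunal) claims are never citable.»

WHY (road FP owner d1-p3's N7 PLAN v1 §2 (MS-1): «C^{[N]}(u,u′) := N^{−p_C}·C((u−u′)/N) (canonical d = 4 rescaling; p_C = 2 in continuum normalisation —
in the road's adopted units `sfStep/smStep` the exponent is fixed by `unitK`, to be read off, not asserted here)»).  The perfect resolvents are
`KPerf Lc sf sm m = limMKerOf (j ↦ unitK (sf j) (sm j) (KTot (Lc^(j+m)) (Lc^j)))` (`FP/PerfectObjectsT`).  The finite-level (MS-1)
(`kTot_pair_telescoping_step`) is an identity of the UNSCALED (j, m)-resolvents; this file rewrites it for the RESCALED ones `U_j KTot_{j,m}`,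
`U_j := unitK (sf j) (sm j)`, with the next one step rescaled in ITS units `U_{j+m}`: the two covariance pairings scale by `(sf j)²`
(`pair_unitK_ff`), the composite by `(sf j · sm j)²·(sf (j+m))²` (`comp_unitK_liftW_unitK_ff`: its outer factors are the `(inl, inr)` ∕ `(inr, inl)`
blocks, the lift carries the field–field block), so the composite's scalar becomes `c_j := ((Lc^j)^(d+2))² ∕ (sm j · sf (j+m))²`
(`kTot_pair_telescoping_units`).  For ANY geometric pair `sf j = Lc^j`, `sm j = Lc^{j(d+1)}` — the road's `sfStep`∕`smStep` at `d + 1 = 4` —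
`c_j = (Lc^m)^{−2}` for every `j` (`unitScalar_adopted`, `kTot_pair_telescoping_adopted`): the correction is `n^{−2}`× the lifted (= dilated onto
`n·ℤ^{d+1}`, `n = Lc^m`) rescaled one-step kernel between the rescaled (j, m)-minimisers — the N7 PLAN's `p_C = 2`, now a kernel-checked scalar
identity rather than a reading.  What remains for MS-1 proper is ONLY the passage `j → ∞` (entrywise limits of the three families = X1m rows;
dominated convergence of the composite's double coarse series).

CONTENT (all [folklore]; general `d`, any `Lc ≥ 1`, arbitrary unit sequences unless stated).
* §1 `pair_unitK_ff`, `comp_unitK_liftW_unitK_ff`.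
* §2 **`kTot_pair_telescoping_units`**.
* §3 `unitScalar_adopted`, **`kTot_pair_telescoping_adopted`** (`sf j = Lc^j`, `sm j = Lc^{j(d+1)}`; scalar `((Lc^m)²)⁻¹`).
Unit `b2b-balaban-gan24-formalise-leaf-05` (gen 33; cross-lane idle G-an2-4 swarm leaf seat on road FP's sub-row MS-1-FIN).
-/

noncomputable section

namespace Summit.QuantumFields.BalabanUV.Beta.FP.PerfectTelescopingFiniteUnits

open Finset
open scoped BigOperators
open Literature.MathematicalPhysics.QuantumFieldTheory.Balaban1983to89
open Literature.MathematicalPhysics.QuantumFieldTheory.Balaban1983to89.Beta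
open AffineAveraging (Form1 codiff₁)
open ExpKernelCalculus (MKer comp)
open OneStepResolventKernel (Fib KInv)
open OneStepKernelFamily (dec KInvStep)
open InterLevelTransport (liftW slotW slotW_true)
open ResolventComposition (slot_true)
open ResolventCompositionStepB (tsum_pair_eq_sum exists_support_finset)
open Summit.QuantumFields.BalabanUV.Beta.HessKerDressedUnits (unitK unitK_apply legScale legScale_inl legScale_inr)
open Summit.QuantumFields.BalabanUV.Beta.FP.PerfectObjects (KTot)
open Summit.QuantumFields.BalabanUV.Beta.FP.PerfectTelescopingFiniteComposite (comp_liftW_comp_apply kTot_pair_telescoping_step)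

variable {d : ℕ}

/-! ## §1 Units through pairings and through the lifted composite -/

/-- [folklore] **A FIELD–FIELD PAIRING OF A RESCALED KERNEL** is `sf²`× the pairing of the kernel. -/
theorem pair_unitK_ff (sf sm : ℝ) (K : MKer (d + 1) (Fib d)) (G G' : Form1 (d + 1) ℝ) :
    (∑' x', ∑' y', ∑ κ, ∑ l, G κ x' * unitK sf sm K x' y' (Sum.inl κ) (Sum.inl l) * G' l y')
      = sf * sf * ∑' x', ∑' y', ∑ κ, ∑ l, G κ x' * K x' y' (Sum.inl κ) (Sum.inl l) * G' l y' := by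
  rw [← tsum_mul_left]
  refine tsum_congr fun x' => ?_
  rw [← tsum_mul_left]
  refine tsum_congr fun y' => ?_
  rw [Finset.mul_sum]
  refine Finset.sum_congr rfl fun κ _ => ?_
  rw [Finset.mul_sum]
  refine Finset.sum_congr rfl fun l _ => ?_
  rw [unitK_apply, legScale_inl, legScale_inl]
  ring

/-- [folklore] **THE LIFTED COMPOSITE OF RESCALED KERNELS** (field–field entry): the outer factors contribute `sf·sm` each (they are `(inl, inr)` ∕
`(inr, inl)` blocks), the lifted middle kernel its field–field units `sf′²`:
`[U A ∘ liftW P true true (U′ S) ∘ U B]_ff = (sf·sm)²·sf′² · [A ∘ liftW P true true S ∘ B]_ff`. -/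
theorem comp_unitK_liftW_unitK_ff (P : ℕ) [NeZero P] (sf sm sf' sm' : ℝ) (A S B : MKer (d + 1) (Fib d)) (x y : Fin (d + 1) → ℤ)
    (κ l : Fin (d + 1)) :
    comp (unitK sf sm A) (comp (liftW P true true (unitK sf' sm' S)) (unitK sf sm B)) x y (Sum.inl κ) (Sum.inl l)
      = (sf * sm) * (sf * sm) * (sf' * sf') * comp A (comp (liftW P true true S) B) x y (Sum.inl κ) (Sum.inl l) := by
  rw [comp_liftW_comp_apply, comp_liftW_comp_apply, ← tsum_mul_left]
  refine tsum_congr fun z' => ?_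
  rw [Finset.mul_sum]
  refine Finset.sum_congr rfl fun μ _ => ?_
  have inner : (∑' w', ∑ ν, slotW d P true * slotW d P true * unitK sf' sm' S z' w' (InterLevelTransport.slot true μ) (InterLevelTransport.slot true ν)
        * unitK sf sm B ((P : ℤ) • w') y (Sum.inr ν) (Sum.inl l))
      = sf' * sf' * (sm * sf) * ∑' w', ∑ ν, slotW d P true * slotW d P true
          * S z' w' (InterLevelTransport.slot true μ) (InterLevelTransport.slot true ν) * B ((P : ℤ) • w') y (Sum.inr ν) (Sum.inl l) := by
    rw [← tsum_mul_left]
    refine tsum_congr fun w' => ?_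
    rw [Finset.mul_sum]
    refine Finset.sum_congr rfl fun ν _ => ?_
    simp only [slot_true, unitK_apply, legScale_inl, legScale_inr]
    ring
  rw [inner, unitK_apply, legScale_inl, legScale_inr]
  ring

/-! ## §2 The finite-level (MS-1) for the rescaled (j, m)-resolvents -/

variable (Lc : ℕ) [NeZero Lc]

/-- [folklore] **THE FINITE-LEVEL (MS-1) IN UNITS.**  For unit sequences `sf, sm` with `sm j ≠ 0`, `sf (j+m) ≠ 0`, and finitely supported CO-CLOSED
`G, G′` on the step-`j` lattice (`U_i := unitK (sf i) (sm i)`):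
`⟨G, [U_j KTot (Lc^(j+m+1)) (Lc^j)]_ff G′⟩ = ⟨G, ([U_j KTot (Lc^(j+m)) (Lc^j)] − c_j·[U_j KTot_{j,m} ∘ liftW (Lc^m) true true (U_{j+m} (KInvStep Lc (j+m))) ∘ U_j KTot_{j,m}])_ff G′⟩`,
`c_j = ((Lc^j)^(d+2))² ∕ (sm j · sf (j+m))²` — `kTot_pair_telescoping_step` × `(sf j)²`, units pulled through by §1. -/
theorem kTot_pair_telescoping_units (sf sm : ℕ → ℝ) (j m : ℕ) (hsm : sm j ≠ 0) (hsf' : sf (j + m) ≠ 0) (G G' : Form1 (d + 1) ℝ)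
    (hG : ∀ κ, (Function.support (G κ)).Finite) (hG' : ∀ κ, (Function.support (G' κ)).Finite)
    (hcoG : codiff₁ G = 0) (hcoG' : codiff₁ G' = 0) :
    (∑' x', ∑' y', ∑ κ, ∑ l, G κ x' * unitK (sf j) (sm j) (KTot (d := d) (Lc ^ (j + m + 1)) (Lc ^ j)) x' y' (Sum.inl κ) (Sum.inl l) * G' l y')
      = ∑' x', ∑' y', ∑ κ, ∑ l, G κ x' *
          (unitK (sf j) (sm j) (KTot (d := d) (Lc ^ (j + m)) (Lc ^ j)) x' y' (Sum.inl κ) (Sum.inl l)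
            - ((((Lc ^ j : ℕ) : ℝ)) ^ (d + 2) * (((Lc ^ j : ℕ) : ℝ)) ^ (d + 2)) / ((sm j * sf (j + m)) * (sm j * sf (j + m)))
              * comp (unitK (sf j) (sm j) (KTot (d := d) (Lc ^ (j + m)) (Lc ^ j)))
                  (comp (liftW (Lc ^ m) true true (unitK (sf (j + m)) (sm (j + m)) (KInvStep (d := d) Lc (j + m))))
                    (unitK (sf j) (sm j) (KTot (d := d) (Lc ^ (j + m)) (Lc ^ j))))
                  x' y' (Sum.inl κ) (Sum.inl l)) * G' l y' := by
  haveI : NeZero (Lc ^ m) := ⟨pow_ne_zero _ (NeZero.ne Lc)⟩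
  obtain ⟨s, hs⟩ := exists_support_finset G hG
  obtain ⟨s', hs'⟩ := exists_support_finset G' hG'
  have hfin := kTot_pair_telescoping_step (d := d) Lc j m G G' hG hG' hcoG hcoG'
  rw [tsum_pair_eq_sum G G' s s' hs hs', tsum_pair_eq_sum G G' s s' hs hs'] at hfin
  rw [tsum_pair_eq_sum G G' s s' hs hs', tsum_pair_eq_sum G G' s s' hs hs']
  simp only [comp_unitK_liftW_unitK_ff, unitK_apply, legScale_inl]
  -- both sides are `(sf j)²` × the corresponding side of the unscaled identity
  have eL : ∀ (x' y' : Fin (d + 1) → ℤ) (κ l : Fin (d + 1)),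
      G κ x' * (sf j * KTot (d := d) (Lc ^ (j + m + 1)) (Lc ^ j) x' y' (Sum.inl κ) (Sum.inl l) * sf j) * G' l y'
        = sf j * sf j * (G κ x' * KTot (d := d) (Lc ^ (j + m + 1)) (Lc ^ j) x' y' (Sum.inl κ) (Sum.inl l) * G' l y') := by
    intro x' y' κ l; ring
  have eR : ∀ (x' y' : Fin (d + 1) → ℤ) (κ l : Fin (d + 1)),
      G κ x' * (sf j * KTot (d := d) (Lc ^ (j + m)) (Lc ^ j) x' y' (Sum.inl κ) (Sum.inl l) * sf j
          - ((((Lc ^ j : ℕ) : ℝ)) ^ (d + 2) * (((Lc ^ j : ℕ) : ℝ)) ^ (d + 2)) / ((sm j * sf (j + m)) * (sm j * sf (j + m)))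
            * ((sf j * sm j) * (sf j * sm j) * (sf (j + m) * sf (j + m))
              * comp (KTot (d := d) (Lc ^ (j + m)) (Lc ^ j))
                  (comp (liftW (Lc ^ m) true true (KInvStep (d := d) Lc (j + m))) (KTot (d := d) (Lc ^ (j + m)) (Lc ^ j)))
                  x' y' (Sum.inl κ) (Sum.inl l))) * G' l y'
        = sf j * sf j * (G κ x' * (KTot (d := d) (Lc ^ (j + m)) (Lc ^ j) x' y' (Sum.inl κ) (Sum.inl l)
            - ((((Lc ^ j : ℕ) : ℝ)) ^ (d + 2) * (((Lc ^ j : ℕ) : ℝ)) ^ (d + 2))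
              * comp (KTot (d := d) (Lc ^ (j + m)) (Lc ^ j))
                  (comp (liftW (Lc ^ m) true true (KInvStep (d := d) Lc (j + m))) (KTot (d := d) (Lc ^ (j + m)) (Lc ^ j)))
                  x' y' (Sum.inl κ) (Sum.inl l)) * G' l y') := by
    intro x' y' κ l
    have hQ : (sm j * sf (j + m)) * (sm j * sf (j + m)) ≠ 0 := mul_ne_zero (mul_ne_zero hsm hsf') (mul_ne_zero hsm hsf')
    have key : ((((Lc ^ j : ℕ) : ℝ)) ^ (d + 2) * (((Lc ^ j : ℕ) : ℝ)) ^ (d + 2)) / ((sm j * sf (j + m)) * (sm j * sf (j + m)))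
        * ((sf j * sm j) * (sf j * sm j) * (sf (j + m) * sf (j + m))
          * comp (KTot (d := d) (Lc ^ (j + m)) (Lc ^ j))
              (comp (liftW (Lc ^ m) true true (KInvStep (d := d) Lc (j + m))) (KTot (d := d) (Lc ^ (j + m)) (Lc ^ j)))
              x' y' (Sum.inl κ) (Sum.inl l))
        = sf j * sf j * ((((Lc ^ j : ℕ) : ℝ)) ^ (d + 2) * (((Lc ^ j : ℕ) : ℝ)) ^ (d + 2)
          * comp (KTot (d := d) (Lc ^ (j + m)) (Lc ^ j))
              (comp (liftW (Lc ^ m) true true (KInvStep (d := d) Lc (j + m))) (KTot (d := d) (Lc ^ (j + m)) (Lc ^ j)))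
              x' y' (Sum.inl κ) (Sum.inl l)) := by
      rw [div_mul_eq_mul_div, div_eq_iff hQ]
      ring
    rw [key]
    ring
  simp only [eL, eR, ← Finset.mul_sum]
  rw [hfin]

/-! ## §3 The adopted units: the composite's scalar is `(Lc^m)^{−2}`, independent of `j` -/

omit [NeZero Lc] in
/-- [folklore] **THE UNIT SCALAR IN THE ADOPTED UNITS** `sf j = Lc^j`, `sm j = Lc^{j(d+1)}`: `((Lc^j)^(d+2))² ∕ (Lc^{j(d+1)}·Lc^{j+m})² = ((Lc^m)²)⁻¹`. -/
theorem unitScalar_adopted (hLc : 1 ≤ Lc) (j m : ℕ) :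
    ((((Lc ^ j : ℕ) : ℝ)) ^ (d + 2) * (((Lc ^ j : ℕ) : ℝ)) ^ (d + 2))
        / ((((Lc : ℝ)) ^ (j * (d + 1)) * (Lc : ℝ) ^ (j + m)) * (((Lc : ℝ)) ^ (j * (d + 1)) * (Lc : ℝ) ^ (j + m)))
      = (((Lc : ℝ) ^ m) * ((Lc : ℝ) ^ m))⁻¹ := by
  have hL : (Lc : ℝ) ≠ 0 := by exact_mod_cast (show Lc ≠ 0 by omega)
  have e1 : (((Lc ^ j : ℕ) : ℝ)) ^ (d + 2) = (Lc : ℝ) ^ (j * (d + 1)) * (Lc : ℝ) ^ j := by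
    push_cast
    ring
  have e2 : (Lc : ℝ) ^ (j + m) = (Lc : ℝ) ^ j * (Lc : ℝ) ^ m := pow_add _ _ _
  rw [e1, e2]
  field_simp

/-- [folklore] **THE FINITE-LEVEL (MS-1) IN THE ADOPTED UNITS** (`sf j = Lc^j`, `sm j = Lc^{j(d+1)}` — at `d + 1 = 4` the road's `sfStep`∕`smStep`):
for finitely supported CO-CLOSED `G, G′` on the step-`j` lattice,
`⟨G, [U_j KTot_{j,m+1}]_ff G′⟩ = ⟨G, ([U_j KTot_{j,m}] − (Lc^m)^{−2}·[U_j KTot_{j,m} ∘ liftW (Lc^m) true true (U_{j+m} KInvStep Lc (j+m)) ∘ U_j KTot_{j,m}])_ff G′⟩`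
— the scalar is INDEPENDENT of `j`: «Γ_{n·Lc} = Γ_n + H_n C^{[n]} H_nᵀ, C^{[n]} = n^{−2}·C(·∕n)», `n = Lc^m`, at every finite `j` (N7 PLAN's `p_C = 2`). -/
theorem kTot_pair_telescoping_adopted (hLc : 1 ≤ Lc) (j m : ℕ) (G G' : Form1 (d + 1) ℝ)
    (hG : ∀ κ, (Function.support (G κ)).Finite) (hG' : ∀ κ, (Function.support (G' κ)).Finite)
    (hcoG : codiff₁ G = 0) (hcoG' : codiff₁ G' = 0) :
    (∑' x', ∑' y', ∑ κ, ∑ l, G κ x'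
        * unitK ((Lc : ℝ) ^ j) ((Lc : ℝ) ^ (j * (d + 1))) (KTot (d := d) (Lc ^ (j + m + 1)) (Lc ^ j)) x' y' (Sum.inl κ) (Sum.inl l) * G' l y')
      = ∑' x', ∑' y', ∑ κ, ∑ l, G κ x' *
          (unitK ((Lc : ℝ) ^ j) ((Lc : ℝ) ^ (j * (d + 1))) (KTot (d := d) (Lc ^ (j + m)) (Lc ^ j)) x' y' (Sum.inl κ) (Sum.inl l)
            - (((Lc : ℝ) ^ m) * ((Lc : ℝ) ^ m))⁻¹
              * comp (unitK ((Lc : ℝ) ^ j) ((Lc : ℝ) ^ (j * (d + 1))) (KTot (d := d) (Lc ^ (j + m)) (Lc ^ j)))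
                  (comp (liftW (Lc ^ m) true true
                      (unitK ((Lc : ℝ) ^ (j + m)) ((Lc : ℝ) ^ ((j + m) * (d + 1))) (KInvStep (d := d) Lc (j + m))))
                    (unitK ((Lc : ℝ) ^ j) ((Lc : ℝ) ^ (j * (d + 1))) (KTot (d := d) (Lc ^ (j + m)) (Lc ^ j))))
                  x' y' (Sum.inl κ) (Sum.inl l)) * G' l y' := by
  have hL : (Lc : ℝ) ≠ 0 := by exact_mod_cast (show Lc ≠ 0 by omega)
  have h := kTot_pair_telescoping_units (d := d) Lc (fun i => (Lc : ℝ) ^ i) (fun i => (Lc : ℝ) ^ (i * (d + 1))) j m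
    (pow_ne_zero _ hL) (pow_ne_zero _ hL) G G' hG hG' hcoG hcoG'
  rw [unitScalar_adopted Lc hLc j m] at h
  exact h

end Summit.QuantumFields.BalabanUV.Beta.FP.PerfectTelescopingFiniteUnits

end
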